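import Summits.QuantumFields.YangMills.Theorems.BalabanUVNodesN22GenSchemasOfAnalyticReading

/-!
# BalabanUVNodes ∕ node N22 = NE9 — THE NON-EXPANSIVE ANALYTIC READING READ DIRECTLY: UNIFORM first- and second-order coupling letters of the generated terms (NO growth in
# the age) by strong induction on the creation step, when node00-def-W1's one-step map admits module J57's analytic reading with margin ratio `4M_b c_w∕ϱ < 1` — the input
# shape of module J46's `q = 1` edition, so ROAD 2 then closes under the letter block's STANDING row `ℓ.θ₅ ≤ ℓ.ω²` (module J63)

Cell `pub-ymgap`, HUMAN RULING D-0062 (Track A), R134 seat `pub-ymgap-dag-n22-c` (strategy s1), generation 18, module J62.  THEOREMS ONLY (no `def`, no `sorry`, standard axioms);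
`--kind proof --supports stmt-QuantumFields-27366 --as helper` (K3⁸ `SpineGivenEndpointR13SepCoPHV`), COUNT-NEUTRAL.  Imports module J57 `…N22GenSchemasOfAnalyticReading` (the
Banach devices `norm_sub_le_of_ballMargin`, `norm_threePoint_le_of_ballMargin`; through it J53, def-W1's `HistoryRecursionOfRecord`, J38's `update_mem_window`, J39's
`histPrefix_update`).  Nothing re-declared.

WHY (sharpening of modules J58∕J59).  J58∕J59 feed the analytic reading (AR) through J51's SUM-channel recursion (pub-balaban's `renewalSuper_geometric` ∘ dag-n22-a's
`secondDiff_of_stepSecondDiff`): with age weights `aw ≤ c_w ω₁^{k−j}` the letters grow like `ν^{age}`, `ν > ω₁ + 4M_b c_w∕ϱ`, `ν ≥ (ω₁ + 4M_b c_w∕ϱ)²`, and K3's row becomes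
`ℓ.θ₅·ν ≤ ℓ.ω²` — N18's rate coupled to the margin.  But a sup-type reading bounds the new term's variation by the MAXIMUM of the older levels' variations, not their sum; read
DIRECTLY (strong induction on the creation step `k`, no channel bookkeeping), the letters do NOT grow at all as soon as the step is NON-EXPANSIVE in pub-balaban's sense
(`T4HistoryLipschitzOuter` §5 `nonexpansive_of_radius`: `4B₀τu ≤ R − s`), here **`4M_b c_w∕ϱ ≤ 1`** (first order) ∕ **`< 1`** (second order):
* §1 ★★ `termLipschitz_toClusterTower_of_analyticReadingNonexpansive` — **`‖E^{(k+1)}(X; g∣g_i:=s) − E^{(k+1)}(X; g∣g_i:=s′)‖ ≤ ℓ₁·e^{−κd}·|s − s′|`** for EVERY `i` and `k`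
  (`i > k`: not read; `i = k`: the last-coupling schema `lam ≤ ℓ₁`; `i < k`: (AR) at the read generated families, entries `≤ c_w ℓ₁|s − s′|` by induction, `× 4M_b∕ϱ ≤ ℓ₁`);
* §2 ★★ `termSecondDiff_toClusterTower_of_analyticReadingNonexpansive` — **second differences `≤ M₂·e^{−κd}·d²`, `M₂ = max ℓ₂ (64M_b c_w²ℓ₁²∕(ϱ²(1 − 4M_b c_w∕ϱ)))` UNIFORM**
  (J57's three-point estimate at the three read generated families; `(4M_b c_w∕ϱ)·M₂ + 64M_b c_w²ℓ₁²∕ϱ² ≤ M₂`);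
* §3 ★★ `termSecondDiffAt_box_truncRun_toClusterTower_of_analyticReadingNonexpansive` — §2 in the box-history shape of J45∕J46's `hΔ` for def-W1's run towers
  `truncRun K (toClusterTower G)` (J53's `termSecondDiffAt_box_truncRun`).
So in the non-expansive regime ROAD 2 needs NO growth rate `ν`: module J63 feeds §3 to J46 §1b (`…_termSecondDiff_outputBound`, `q = 1`) under the STANDING rows of the letter
block (`ℓ.θ₅ ≤ ℓ.ω²`, `ℓ.κ ≤ δ₁`, the `C₉` row) — N18's rate DECOUPLED from the recursion's constants; the only smallness is the margin ratio `4M_b c_w∕ϱ < 1` («ε₁ sufficiently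
small» type, [II] p. 18, in the cell's units).  (In the expansive regime `4M_b c_w∕ϱ ≥ 1` modules J58∕J59 remain the editions to use.)

HONEST FRAMING (binding).  Count-neutral COMPOSITION by a direct induction over def-W1's recursion (`recTerm_succ`, `termC_toClusterTower`, `olderOf_recTerm_update_of_le`,
`termC_congr_prefix`); (AR), the last-coupling schemas and (Adm-run) are DISPLAYED HYPOTHESES (cell's readings of [II] (2.14)–(2.15) p. 15 and [I] p. 263; GAPS G-ne9p2-5,
G-t4-U3-1; producer: node N10 ∕ NODE A on def-T's generator of record; inhabited by every generator ignoring `(z, old)` within the output bound — A5, conditional content); NO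
estimate of Bałaban's is proved or asserted; nothing of the record is constructed or claimed to meet the displayed inputs.  N22 is NOT discharged (typed 28∕28 · discharged 5∕27
UNCHANGED); K3⁸ OPEN and NOT claimed; NE9 is NOT IN PRINT for d = 4; no count claim; one finite 𝕋⁴ programme at fixed ε — R4 closes the CONDITIONAL rung `BalabanLadder.UV` only;
NOTHING about the continuum limit, ℝ⁴, infinite volume, OS axioms, a mass gap or the Clay problem is proved or claimed.  References (TYPES only): [I] = Bałaban, CMP 109 (1987)
(0.23) p. 256, §1 p. 263, (2.12)–(2.13) p. 268, §5 p. 298; [II] = CMP 116 (1988) (1.41) p. 11, (2.13)–(2.15) pp. 14–15, p. 18.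
-/

noncomputable section

open Set Metric
open scoped BigOperators

namespace YMDAG.N22.TermRecursion

open Literature.MathematicalPhysics.QuantumFieldTheory.Balaban1983to89
open Literature.MathematicalPhysics.QuantumFieldTheory.Balaban1983to89.T4OutputRate (Window)
open Literature.MathematicalPhysics.QuantumFieldTheory.Balaban1983to89.Node00.Sect2 (domSys CPair)
open Literature.MathematicalPhysics.QuantumFieldTheory.Balaban1983to89.Node00.W1
open YMDAG.N22.KernelFading (update_mem_window)
open YMDAG.N22.WindowedSecondDiff (histPrefix_update)

/-! ## §1–§3 Uniform letters of the generated terms from a non-expansive analytic reading (one generator `G`, space table `sp`, admissibility `Adm`) -/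
section Gen

variable {P : Params} {𝔸 : Type} {M : ℕ} (G : GenTower P 𝔸 M) (sp : (k : ℕ) → (domSys P M (k + 1)).Dom → Set (CPair P 𝔸))
  (Adm : (k : ℕ) → OlderTerms P 𝔸 M k → Prop)
  {Pot : ℕ → Type*} [∀ k, NormedAddCommGroup (Pot k)] [∀ k, NormedSpace ℂ (Pot k)]
  (ρ : (k : ℕ) → OlderTerms P 𝔸 M k → Pot k) (A : (k : ℕ) → ℝ → CPair P 𝔸 → (domSys P M (k + 1)).Dom → Pot k → ℂ)

/-- ★★ **UNIFORM FIRST-ORDER COUPLING LETTERS OF THE GENERATED TERMS FROM A NON-EXPANSIVE ANALYTIC READING — direct induction on the creation step, no channel bookkeeping.**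
(AR-fact)∕(AR-holo)∕(AR-adm)∕(AR-dom₁) with age weights `0 ≤ aw k j ≤ c_w` (no decay asked), (Adm-run), the first-order LAST-coupling schema (`lam ≤ ℓ₁`), and the NON-EXPANSIVE
MARGIN **`4M_b c_w∕ϱ ≤ 1`** (pub-balaban's `nonexpansive_of_radius`: the analyticity margin is at least four output bounds in channel units) ⟹ for EVERY creation step `k + 1`,
window history `g`, coordinate `i`, values `s, s′ ∈ ]0, γ]`, domain `X` and admissible `φ`:
**`‖E^{(k+1)}(X; g∣g_i:=s; φ) − E^{(k+1)}(X; g∣g_i:=s′; φ)‖ ≤ ℓ₁·e^{−κd_{k+1}(X)}·|s − s′|`** — UNIFORM in the age `k − i` (strong induction: `i > k` not read;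
`i = k` the last-coupling schema; `i < k` through the older terms by `norm_sub_le_of_ballMargin` at the read generated families, whose weighted entries are `≤ c_w ℓ₁|s − s′|` by the
induction hypothesis, times `4M_b∕ϱ`, `≤ ℓ₁|s − s′|` by the margin). [folklore] -/
theorem termLipschitz_toClusterTower_of_analyticReadingNonexpansive {γ κ R r₀ ϱ Mb ℓ₁ cw : ℝ} {aw : ℕ → ℕ → ℝ} {lam : ℕ → ℝ}
    (hϱ : 0 < ϱ) (hR : r₀ + ϱ < R)
    (hGA : ∀ (k : ℕ), ∀ t ∈ Ioc (0 : ℝ) γ, ∀ (old : OlderTerms P 𝔸 M k), Adm k old → ∀ (X : (domSys P M (k + 1)).Dom), ∀ φ ∈ sp k X,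
      (G k).E ((t : ℝ) : ℂ) old φ X = A k t φ X (ρ k old))
    (hA : ∀ (k : ℕ), ∀ t ∈ Ioc (0 : ℝ) γ, ∀ (X : (domSys P M (k + 1)).Dom), ∀ φ ∈ sp k X, DifferentiableOn ℂ (A k t φ X) (ball 0 R))
    (hMb : ∀ (k : ℕ), ∀ t ∈ Ioc (0 : ℝ) γ, ∀ (X : (domSys P M (k + 1)).Dom), ∀ φ ∈ sp k X, ∀ p ∈ ball (0 : Pot k) R,
      ‖A k t φ X p‖ ≤ Mb * Real.exp (-(κ * (domSys P M (k + 1)).dj X)))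
    (hAdmr : ∀ (k : ℕ) (old : OlderTerms P 𝔸 M k), Adm k old → ‖ρ k old‖ ≤ r₀)
    (hρ₁ : ∀ (k : ℕ) (o o' : OlderTerms P 𝔸 M k), Adm k o → Adm k o' → ∀ (B : ℝ), 0 ≤ B →
      (∀ (k' : ℕ) (hk' : k' < k) (Y : (domSys P M (k' + 1)).Dom), ∀ φ' ∈ sp k' Y,
        aw k (k' + 1) * (Real.exp (κ * (domSys P M (k' + 1)).dj Y) * ‖o ⟨k' + 1, Nat.succ_lt_succ hk'⟩ Y φ' - o' ⟨k' + 1, Nat.succ_lt_succ hk'⟩ Y φ'‖) ≤ B) →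
      ‖ρ k o - ρ k o'‖ ≤ B)
    (haw : ∀ k j, 0 ≤ aw k j) (hawcw : ∀ k j, aw k j ≤ cw)
    (hAdm : ∀ g ∈ Window γ, ∀ k, Adm k (olderOf (recTerm G fun n => ((g n : ℝ) : ℂ)) k))
    (hGt : ∀ (k : ℕ), ∀ t ∈ Ioc (0 : ℝ) γ, ∀ t' ∈ Ioc (0 : ℝ) γ, ∀ (old : OlderTerms P 𝔸 M k), Adm k old → ∀ (X : (domSys P M (k + 1)).Dom), ∀ φ ∈ sp k X,
      ‖(G k).E ((t : ℝ) : ℂ) old φ X - (G k).E ((t' : ℝ) : ℂ) old φ X‖ ≤ Real.exp (-(κ * (domSys P M (k + 1)).dj X)) * (lam k * |t - t'|))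
    (hlam : ∀ k, lam k ≤ ℓ₁) (hℓ₁ : 0 ≤ ℓ₁) (hC : 4 * Mb * cw / ϱ ≤ 1) :
    ∀ (k : ℕ), ∀ g ∈ Window γ, ∀ (i : ℕ), ∀ s ∈ Ioc (0 : ℝ) γ, ∀ s' ∈ Ioc (0 : ℝ) γ, ∀ (X : (domSys P M (k + 1)).Dom), ∀ φ ∈ sp k X,
      ‖termC (toClusterTower G) (k + 1) X (Function.update g i s) φ - termC (toClusterTower G) (k + 1) X (Function.update g i s') φ‖ ≤
        ℓ₁ * Real.exp (-(κ * (domSys P M (k + 1)).dj X)) * |s - s'| := by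
  intro k
  induction k using Nat.strong_induction_on with
  | _ k ih =>
  intro g hg i s hs s' hs' X φ hφ
  set e : ℝ := Real.exp (-(κ * (domSys P M (k + 1)).dj X)) with he
  have he0 : 0 < e := Real.exp_pos _
  have hcw : 0 ≤ cw := (haw 0 0).trans (hawcw 0 0)
  rcases lt_trichotomy i k with hik | rfl | hki
  · -- `i < k`: the coupling enters through the older terms only
    have hgs : Function.update g i s ∈ Window γ := update_mem_window hg i hs
    have hgs' : Function.update g i s' ∈ Window γ := update_mem_window hg i hs'
    have hki : k ≠ i := ne_of_gt hik
    rw [termC_toClusterTower, termC_toClusterTower, recTerm_succ, recTerm_succ, Function.update_of_ne hki, Function.update_of_ne hki,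
      hGA k (g k) (hg k) _ (hAdm _ hgs k) X φ hφ, hGA k (g k) (hg k) _ (hAdm _ hgs' k) X φ hφ]
    have hB' : 0 ≤ cw * ℓ₁ * |s - s'| := by positivity
    have hent : ∀ (k' : ℕ) (hk' : k' < k) (Y : (domSys P M (k' + 1)).Dom), ∀ φ' ∈ sp k' Y,
        aw k (k' + 1) * (Real.exp (κ * (domSys P M (k' + 1)).dj Y) *
          ‖olderOf (recTerm G fun n => ((Function.update g i s n : ℝ) : ℂ)) k ⟨k' + 1, Nat.succ_lt_succ hk'⟩ Y φ' -
            olderOf (recTerm G fun n => ((Function.update g i s' n : ℝ) : ℂ)) k ⟨k' + 1, Nat.succ_lt_succ hk'⟩ Y φ'‖) ≤ cw * ℓ₁ * |s - s'| := by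
      intro k' hk' Y φ' hφ'
      rw [olderOf_apply, olderOf_apply, ← termC_toClusterTower, ← termC_toClusterTower]
      have h := ih k' hk' g hg i s hs s' hs' Y φ' hφ'
      have hpos : 0 < Real.exp (κ * (domSys P M (k' + 1)).dj Y) := Real.exp_pos _
      have h2 : Real.exp (κ * (domSys P M (k' + 1)).dj Y) *
          ‖termC (toClusterTower G) (k' + 1) Y (Function.update g i s) φ' - termC (toClusterTower G) (k' + 1) Y (Function.update g i s') φ'‖ ≤ ℓ₁ * |s - s'| := by
        calc _ ≤ Real.exp (κ * (domSys P M (k' + 1)).dj Y) * (ℓ₁ * Real.exp (-(κ * (domSys P M (k' + 1)).dj Y)) * |s - s'|) :=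
              mul_le_mul_of_nonneg_left h hpos.le
          _ = ℓ₁ * |s - s'| := by
              rw [Real.exp_neg]; field_simp
      calc _ ≤ aw k (k' + 1) * (ℓ₁ * |s - s'|) := mul_le_mul_of_nonneg_left h2 (haw _ _)
        _ ≤ cw * (ℓ₁ * |s - s'|) := mul_le_mul_of_nonneg_right (hawcw _ _) (by positivity)
        _ = cw * ℓ₁ * |s - s'| := by ring
    have hρ := hρ₁ k _ _ (hAdm _ hgs k) (hAdm _ hgs' k) _ hB' hent
    have h := norm_sub_le_of_ballMargin hϱ hR (hA k (g k) (hg k) X φ hφ) (hMb k (g k) (hg k) X φ hφ) (hAdmr k _ (hAdm _ hgs k)) (hAdmr k _ (hAdm _ hgs' k))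
    have hr₀ : 0 ≤ r₀ := (norm_nonneg _).trans (hAdmr k _ (hAdm _ hgs k))
    have hMb0 : 0 ≤ Mb := by
      have h0 := hMb k (g k) (hg k) X φ hφ 0 (mem_ball_self (by linarith))
      exact nonneg_of_mul_nonneg_left ((norm_nonneg _).trans h0) he0
    calc _ ≤ 4 * (Mb * e) / ϱ * ‖ρ k (olderOf (recTerm G fun n => ((Function.update g i s n : ℝ) : ℂ)) k) -
          ρ k (olderOf (recTerm G fun n => ((Function.update g i s' n : ℝ) : ℂ)) k)‖ := h
      _ ≤ 4 * (Mb * e) / ϱ * (cw * ℓ₁ * |s - s'|) := mul_le_mul_of_nonneg_left hρ (by positivity)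
      _ = 4 * Mb * cw / ϱ * (ℓ₁ * e * |s - s'|) := by ring
      _ ≤ 1 * (ℓ₁ * e * |s - s'|) := mul_le_mul_of_nonneg_right hC (by positivity)
      _ = ℓ₁ * e * |s - s'| := one_mul _
  · -- `i = k`: the last coupling; the generated older terms do not read it
    rw [termC_toClusterTower, termC_toClusterTower, recTerm_succ, recTerm_succ, olderOf_recTerm_update_of_le G g le_rfl s,
      olderOf_recTerm_update_of_le G g le_rfl s', Function.update_self, Function.update_self]
    have h := hGt i s hs s' hs' _ (hAdm g hg i) X φ hφ
    calc _ ≤ e * (lam i * |s - s'|) := h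
      _ ≤ e * (ℓ₁ * |s - s'|) := by gcongr; exact hlam i
      _ = ℓ₁ * e * |s - s'| := by ring
  · -- `i > k`: the level-`(k+1)` term does not read `g_i`
    rw [termC_congr_prefix (toClusterTower G) (k + 1) X (g := Function.update g i s) (g' := Function.update g i s')
      (fun n hn => by rw [Function.update_of_ne (by omega), Function.update_of_ne (by omega)]) φ, sub_self, norm_zero]
    positivity

/-- ★★ **UNIFORM SECOND-DIFFERENCE LETTERS OF THE GENERATED TERMS FROM A STRICTLY NON-EXPANSIVE ANALYTIC READING — direct induction, NO growth in the age.**  Under the inputs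
of `termLipschitz_toClusterTower_of_analyticReadingNonexpansive`, (AR-dom₂), the second-order LAST-coupling schema (`lam₂ ≤ ℓ₂`) and the STRICT margin **`4M_b c_w∕ϱ < 1`**:
for every creation step `k + 1`, window history `g`, coordinate `i`, steps `t ± d ∈ ]0, γ]` (`d > 0`), domain `X` and admissible `φ`:
**`‖E^{(k+1)}(X; g∣g_i:=t+d) − 2E^{(k+1)}(X; g∣g_i:=t) + E^{(k+1)}(X; g∣g_i:=t−d)‖ ≤ M₂·e^{−κd_{k+1}(X)}·d²`**, **`M₂ = max ℓ₂ (64M_b c_w²ℓ₁²∕(ϱ²(1 − 4M_b c_w∕ϱ)))` UNIFORM in the age**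
(strong induction: `i > k` not read; `i = k` the last-coupling schema; `i < k` §1's THREE-POINT estimate of J57 at the three read generated families — linear channel `(4M_b∕ϱ)·c_w M₂ d²`
by the induction hypothesis, variance channel `(16M_b∕ϱ²)·(2c_w ℓ₁ d)²` by the first-order letters — and `(4M_b c_w∕ϱ)M₂ + 64M_b c_w²ℓ₁²∕ϱ² ≤ M₂`).  Compare module J51∕J58: the
SUM-channel recursion gives the growing table `L₂·ν^{k−i}`, `ν > ω₁ + c`; the sup-type reading read DIRECTLY gives no growth once the step is non-expansive. [folklore] -/
theorem termSecondDiff_toClusterTower_of_analyticReadingNonexpansive {γ κ R r₀ ϱ Mb ℓ₁ ℓ₂ cw : ℝ} {aw : ℕ → ℕ → ℝ} {lam lam₂ : ℕ → ℝ}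
    (hϱ : 0 < ϱ) (hR : r₀ + ϱ < R)
    (hGA : ∀ (k : ℕ), ∀ t ∈ Ioc (0 : ℝ) γ, ∀ (old : OlderTerms P 𝔸 M k), Adm k old → ∀ (X : (domSys P M (k + 1)).Dom), ∀ φ ∈ sp k X,
      (G k).E ((t : ℝ) : ℂ) old φ X = A k t φ X (ρ k old))
    (hA : ∀ (k : ℕ), ∀ t ∈ Ioc (0 : ℝ) γ, ∀ (X : (domSys P M (k + 1)).Dom), ∀ φ ∈ sp k X, DifferentiableOn ℂ (A k t φ X) (ball 0 R))
    (hMb : ∀ (k : ℕ), ∀ t ∈ Ioc (0 : ℝ) γ, ∀ (X : (domSys P M (k + 1)).Dom), ∀ φ ∈ sp k X, ∀ p ∈ ball (0 : Pot k) R,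
      ‖A k t φ X p‖ ≤ Mb * Real.exp (-(κ * (domSys P M (k + 1)).dj X)))
    (hAdmr : ∀ (k : ℕ) (old : OlderTerms P 𝔸 M k), Adm k old → ‖ρ k old‖ ≤ r₀)
    (hρ₁ : ∀ (k : ℕ) (o o' : OlderTerms P 𝔸 M k), Adm k o → Adm k o' → ∀ (B : ℝ), 0 ≤ B →
      (∀ (k' : ℕ) (hk' : k' < k) (Y : (domSys P M (k' + 1)).Dom), ∀ φ' ∈ sp k' Y,
        aw k (k' + 1) * (Real.exp (κ * (domSys P M (k' + 1)).dj Y) * ‖o ⟨k' + 1, Nat.succ_lt_succ hk'⟩ Y φ' - o' ⟨k' + 1, Nat.succ_lt_succ hk'⟩ Y φ'‖) ≤ B) →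
      ‖ρ k o - ρ k o'‖ ≤ B)
    (hρ₂ : ∀ (k : ℕ) (o₁ o₂ o₃ : OlderTerms P 𝔸 M k), Adm k o₁ → Adm k o₂ → Adm k o₃ → ∀ (B : ℝ), 0 ≤ B →
      (∀ (k' : ℕ) (hk' : k' < k) (Y : (domSys P M (k' + 1)).Dom), ∀ φ' ∈ sp k' Y,
        aw k (k' + 1) * (Real.exp (κ * (domSys P M (k' + 1)).dj Y) *
          ‖o₁ ⟨k' + 1, Nat.succ_lt_succ hk'⟩ Y φ' - 2 * o₂ ⟨k' + 1, Nat.succ_lt_succ hk'⟩ Y φ' + o₃ ⟨k' + 1, Nat.succ_lt_succ hk'⟩ Y φ'‖) ≤ B) →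
      ‖ρ k o₁ - (2 : ℂ) • ρ k o₂ + ρ k o₃‖ ≤ B)
    (haw : ∀ k j, 0 ≤ aw k j) (hawcw : ∀ k j, aw k j ≤ cw)
    (hAdm : ∀ g ∈ Window γ, ∀ k, Adm k (olderOf (recTerm G fun n => ((g n : ℝ) : ℂ)) k))
    (hGt : ∀ (k : ℕ), ∀ t ∈ Ioc (0 : ℝ) γ, ∀ t' ∈ Ioc (0 : ℝ) γ, ∀ (old : OlderTerms P 𝔸 M k), Adm k old → ∀ (X : (domSys P M (k + 1)).Dom), ∀ φ ∈ sp k X,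
      ‖(G k).E ((t : ℝ) : ℂ) old φ X - (G k).E ((t' : ℝ) : ℂ) old φ X‖ ≤ Real.exp (-(κ * (domSys P M (k + 1)).dj X)) * (lam k * |t - t'|))
    (hlam : ∀ k, lam k ≤ ℓ₁) (hℓ₁ : 0 ≤ ℓ₁)
    (hG2last : ∀ (k : ℕ) (old : OlderTerms P 𝔸 M k), Adm k old → ∀ (t d : ℝ), 0 < d → t - d ∈ Ioc (0 : ℝ) γ → t + d ∈ Ioc (0 : ℝ) γ →
      ∀ (X : (domSys P M (k + 1)).Dom), ∀ φ ∈ sp k X,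
        ‖(G k).E ((t + d : ℝ) : ℂ) old φ X - 2 * (G k).E ((t : ℝ) : ℂ) old φ X + (G k).E ((t - d : ℝ) : ℂ) old φ X‖ ≤
          Real.exp (-(κ * (domSys P M (k + 1)).dj X)) * (lam₂ k * d ^ 2))
    (hlam₂ : ∀ k, lam₂ k ≤ ℓ₂) (hℓ₂ : 0 ≤ ℓ₂) (hC1 : 4 * Mb * cw / ϱ < 1) :
    ∀ (k : ℕ), ∀ g ∈ Window γ, ∀ (i : ℕ) (t d : ℝ), 0 < d → t - d ∈ Ioc (0 : ℝ) γ → t + d ∈ Ioc (0 : ℝ) γ →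
      ∀ (X : (domSys P M (k + 1)).Dom), ∀ φ ∈ sp k X,
        ‖termC (toClusterTower G) (k + 1) X (Function.update g i (t + d)) φ - 2 * termC (toClusterTower G) (k + 1) X (Function.update g i t) φ +
            termC (toClusterTower G) (k + 1) X (Function.update g i (t - d)) φ‖ ≤
          max ℓ₂ (64 * Mb * cw ^ 2 / ϱ ^ 2 * ℓ₁ ^ 2 / (1 - 4 * Mb * cw / ϱ)) * Real.exp (-(κ * (domSys P M (k + 1)).dj X)) * d ^ 2 := by
  have hL := termLipschitz_toClusterTower_of_analyticReadingNonexpansive G sp Adm ρ A hϱ hR hGA hA hMb hAdmr hρ₁ haw hawcw hAdm hGt hlam hℓ₁ hC1.le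
  set M₂ : ℝ := max ℓ₂ (64 * Mb * cw ^ 2 / ϱ ^ 2 * ℓ₁ ^ 2 / (1 - 4 * Mb * cw / ϱ)) with hM₂
  have hM₂0 : 0 ≤ M₂ := hℓ₂.trans (le_max_left _ _)
  have hcw : 0 ≤ cw := (haw 0 0).trans (hawcw 0 0)
  intro k
  induction k using Nat.strong_induction_on with
  | _ k ih =>
  intro g hg i t d hd hm hp X φ hφ
  have ht : t ∈ Ioc (0 : ℝ) γ := ⟨by linarith [hm.1], by linarith [hp.2]⟩
  set e : ℝ := Real.exp (-(κ * (domSys P M (k + 1)).dj X)) with he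
  have he0 : 0 < e := Real.exp_pos _
  rcases lt_trichotomy i k with hik | rfl | hki
  · -- `i < k`: the three-point estimate at the read generated families
    have hgp : Function.update g i (t + d) ∈ Window γ := update_mem_window hg i hp
    have hgt : Function.update g i t ∈ Window γ := update_mem_window hg i ht
    have hgm : Function.update g i (t - d) ∈ Window γ := update_mem_window hg i hm
    have hki : k ≠ i := ne_of_gt hik
    rw [termC_toClusterTower, termC_toClusterTower, termC_toClusterTower, recTerm_succ, recTerm_succ, recTerm_succ, Function.update_of_ne hki,
      Function.update_of_ne hki, Function.update_of_ne hki, hGA k (g k) (hg k) _ (hAdm _ hgp k) X φ hφ, hGA k (g k) (hg k) _ (hAdm _ hgt k) X φ hφ,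
      hGA k (g k) (hg k) _ (hAdm _ hgm k) X φ hφ]
    set o₁ := olderOf (recTerm G fun n => ((Function.update g i (t + d) n : ℝ) : ℂ)) k with ho₁
    set o₂ := olderOf (recTerm G fun n => ((Function.update g i t n : ℝ) : ℂ)) k with ho₂
    set o₃ := olderOf (recTerm G fun n => ((Function.update g i (t - d) n : ℝ) : ℂ)) k with ho₃
    have hMb0 : 0 ≤ Mb := by
      have hr₀ : 0 ≤ r₀ := (norm_nonneg _).trans (hAdmr k _ (hAdm _ hgt k))
      have h0 := hMb k (g k) (hg k) X φ hφ 0 (mem_ball_self (by linarith))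
      exact nonneg_of_mul_nonneg_left ((norm_nonneg _).trans h0) he0
    -- reading an entry bound
    have read : ∀ {nr T x : ℝ} {k' : ℕ} (Y : (domSys P M (k' + 1)).Dom),
        nr ≤ T * Real.exp (-(κ * (domSys P M (k' + 1)).dj Y)) * x → Real.exp (κ * (domSys P M (k' + 1)).dj Y) * nr ≤ T * x := by
      intro nr T x k' Y h
      have hpos : 0 < Real.exp (κ * (domSys P M (k' + 1)).dj Y) := Real.exp_pos _
      calc _ ≤ Real.exp (κ * (domSys P M (k' + 1)).dj Y) * (T * Real.exp (-(κ * (domSys P M (k' + 1)).dj Y)) * x) := mul_le_mul_of_nonneg_left h hpos.le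
        _ = T * x := by rw [Real.exp_neg]; field_simp
    -- the linear channel: second differences of the older generated terms (induction hypothesis)
    have hB₂ : 0 ≤ cw * M₂ * d ^ 2 := by positivity
    have hent₂ : ∀ (k' : ℕ) (hk' : k' < k) (Y : (domSys P M (k' + 1)).Dom), ∀ φ' ∈ sp k' Y,
        aw k (k' + 1) * (Real.exp (κ * (domSys P M (k' + 1)).dj Y) *
          ‖o₁ ⟨k' + 1, Nat.succ_lt_succ hk'⟩ Y φ' - 2 * o₂ ⟨k' + 1, Nat.succ_lt_succ hk'⟩ Y φ' + o₃ ⟨k' + 1, Nat.succ_lt_succ hk'⟩ Y φ'‖) ≤ cw * M₂ * d ^ 2 := by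
      intro k' hk' Y φ' hφ'
      rw [ho₁, ho₂, ho₃, olderOf_apply, olderOf_apply, olderOf_apply, ← termC_toClusterTower, ← termC_toClusterTower, ← termC_toClusterTower]
      have h := ih k' hk' g hg i t d hd hm hp Y φ' hφ'
      have h2 := read Y h
      calc _ ≤ aw k (k' + 1) * (M₂ * d ^ 2) := mul_le_mul_of_nonneg_left h2 (haw _ _)
        _ ≤ cw * (M₂ * d ^ 2) := mul_le_mul_of_nonneg_right (hawcw _ _) (by positivity)
        _ = cw * M₂ * d ^ 2 := by ring
    have hx₂ := hρ₂ k o₁ o₂ o₃ (hAdm _ hgp k) (hAdm _ hgt k) (hAdm _ hgm k) _ hB₂ hent₂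
    -- the variance channel: first differences by the uniform first-order letters
    have hB₁ : 0 ≤ cw * ℓ₁ * |t + d - (t - d)| := by positivity
    have hent₁ : ∀ (k' : ℕ) (hk' : k' < k) (Y : (domSys P M (k' + 1)).Dom), ∀ φ' ∈ sp k' Y,
        aw k (k' + 1) * (Real.exp (κ * (domSys P M (k' + 1)).dj Y) *
          ‖o₁ ⟨k' + 1, Nat.succ_lt_succ hk'⟩ Y φ' - o₃ ⟨k' + 1, Nat.succ_lt_succ hk'⟩ Y φ'‖) ≤ cw * ℓ₁ * |t + d - (t - d)| := by
      intro k' hk' Y φ' hφ'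
      rw [ho₁, ho₃, olderOf_apply, olderOf_apply, ← termC_toClusterTower, ← termC_toClusterTower]
      have h := hL k' g hg i (t + d) hp (t - d) hm Y φ' hφ'
      have h2 := read Y h
      calc _ ≤ aw k (k' + 1) * (ℓ₁ * |t + d - (t - d)|) := mul_le_mul_of_nonneg_left h2 (haw _ _)
        _ ≤ cw * (ℓ₁ * |t + d - (t - d)|) := mul_le_mul_of_nonneg_right (hawcw _ _) (by positivity)
        _ = cw * ℓ₁ * |t + d - (t - d)| := by ring
    have hx₁₃ := hρ₁ k o₁ o₃ (hAdm _ hgp k) (hAdm _ hgm k) _ hB₁ hent₁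
    have hd2 : |t + d - (t - d)| = 2 * d := by rw [show t + d - (t - d) = 2 * d by ring, abs_of_pos (by positivity)]
    rw [hd2] at hx₁₃
    have hsq : ‖ρ k o₁ - ρ k o₃‖ ^ 2 ≤ (cw * ℓ₁ * (2 * d)) ^ 2 := pow_le_pow_left₀ (norm_nonneg _) hx₁₃ 2
    -- the three-point estimate
    have h3 := norm_threePoint_le_of_ballMargin hϱ hR (hA k (g k) (hg k) X φ hφ) (hMb k (g k) (hg k) X φ hφ) (hAdmr k _ (hAdm _ hgp k)) (hAdmr k _ (hAdm _ hgt k))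
      (hAdmr k _ (hAdm _ hgm k))
    have hC0 : 0 < 1 - 4 * Mb * cw / ϱ := by linarith
    have hkey : 4 * Mb * cw / ϱ * M₂ + 64 * Mb * cw ^ 2 / ϱ ^ 2 * ℓ₁ ^ 2 ≤ M₂ := by
      have h1 : 64 * Mb * cw ^ 2 / ϱ ^ 2 * ℓ₁ ^ 2 / (1 - 4 * Mb * cw / ϱ) ≤ M₂ := le_max_right _ _
      rw [div_le_iff₀ hC0] at h1
      nlinarith
    calc ‖A k (g k) φ X (ρ k o₁) - 2 * A k (g k) φ X (ρ k o₂) + A k (g k) φ X (ρ k o₃)‖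
        ≤ 4 * (Mb * e) / ϱ * ‖ρ k o₁ - (2 : ℂ) • ρ k o₂ + ρ k o₃‖ + 16 * (Mb * e) / ϱ ^ 2 * ‖ρ k o₁ - ρ k o₃‖ ^ 2 := h3
      _ ≤ 4 * (Mb * e) / ϱ * (cw * M₂ * d ^ 2) + 16 * (Mb * e) / ϱ ^ 2 * (cw * ℓ₁ * (2 * d)) ^ 2 := by gcongr
      _ = (4 * Mb * cw / ϱ * M₂ + 64 * Mb * cw ^ 2 / ϱ ^ 2 * ℓ₁ ^ 2) * (e * d ^ 2) := by ring
      _ ≤ M₂ * (e * d ^ 2) := mul_le_mul_of_nonneg_right hkey (by positivity)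
      _ = M₂ * e * d ^ 2 := by ring
  · -- `i = k`: the last coupling; the three generated older-term families coincide
    rw [termC_toClusterTower, termC_toClusterTower, termC_toClusterTower, recTerm_succ, recTerm_succ, recTerm_succ,
      olderOf_recTerm_update_of_le G g le_rfl (t + d), olderOf_recTerm_update_of_le G g le_rfl t, olderOf_recTerm_update_of_le G g le_rfl (t - d),
      Function.update_self, Function.update_self, Function.update_self]
    have h := hG2last i _ (hAdm g hg i) t d hd hm hp X φ hφ
    calc _ ≤ e * (lam₂ i * d ^ 2) := h
      _ ≤ e * (M₂ * d ^ 2) := by gcongr; exact (hlam₂ i).trans (le_max_left _ _)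
      _ = M₂ * e * d ^ 2 := by ring
  · -- `i > k`: not read
    have e1 : ∀ s : ℝ, termC (toClusterTower G) (k + 1) X (Function.update g i s) φ = termC (toClusterTower G) (k + 1) X g φ := fun s =>
      termC_congr_prefix (toClusterTower G) (k + 1) X (fun n hn => by rw [Function.update_of_ne (by omega)]) φ
    rw [e1, e1, e1, show termC (toClusterTower G) (k + 1) X g φ - 2 * termC (toClusterTower G) (k + 1) X g φ + termC (toClusterTower G) (k + 1) X g φ = 0 by ring,
      norm_zero]
    positivity

/-- ★★ **THE UNIFORM LETTER IN THE BOX-HISTORY SHAPE OF J45∕J46's `hΔ`, FOR node00-def-W1's RUN TOWERS `truncRun K (toClusterTower G)`** (every run length `K`): under §2's inputs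
and `0 < γ`, **`‖(S k).E(g∣g_i:=t+d) φ X − 2(S k).E(g∣g_i:=t) φ X + (S k).E(g∣g_i:=t−d) φ X‖ ≤ M₂·e^{−κd_{k+1}(X)}·d²`** for `S = truncRun K (toClusterTower G)`, `g ∈ box γ k`,
`i : Fin (k+1)` — §2 on the window history extending the box history by `γ` (`termC_succ`, J39's `histPrefix_update`), then J53's `termSecondDiffAt_box_truncRun` (no term after
the run).  This is module J46's `hΔ` (UNIFORM `M₂`, `q = 1`) — module J63 feeds it to J46 §1b at the record under the STANDING row `ℓ.θ₅ ≤ ℓ.ω²`. [folklore] -/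
theorem termSecondDiffAt_box_truncRun_toClusterTower_of_analyticReadingNonexpansive {γ κ R r₀ ϱ Mb ℓ₁ ℓ₂ cw : ℝ} {aw : ℕ → ℕ → ℝ} {lam lam₂ : ℕ → ℝ}
    (hγ : 0 < γ) (hϱ : 0 < ϱ) (hR : r₀ + ϱ < R)
    (hGA : ∀ (k : ℕ), ∀ t ∈ Ioc (0 : ℝ) γ, ∀ (old : OlderTerms P 𝔸 M k), Adm k old → ∀ (X : (domSys P M (k + 1)).Dom), ∀ φ ∈ sp k X,
      (G k).E ((t : ℝ) : ℂ) old φ X = A k t φ X (ρ k old))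
    (hA : ∀ (k : ℕ), ∀ t ∈ Ioc (0 : ℝ) γ, ∀ (X : (domSys P M (k + 1)).Dom), ∀ φ ∈ sp k X, DifferentiableOn ℂ (A k t φ X) (ball 0 R))
    (hMb : ∀ (k : ℕ), ∀ t ∈ Ioc (0 : ℝ) γ, ∀ (X : (domSys P M (k + 1)).Dom), ∀ φ ∈ sp k X, ∀ p ∈ ball (0 : Pot k) R,
      ‖A k t φ X p‖ ≤ Mb * Real.exp (-(κ * (domSys P M (k + 1)).dj X)))
    (hAdmr : ∀ (k : ℕ) (old : OlderTerms P 𝔸 M k), Adm k old → ‖ρ k old‖ ≤ r₀)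
    (hρ₁ : ∀ (k : ℕ) (o o' : OlderTerms P 𝔸 M k), Adm k o → Adm k o' → ∀ (B : ℝ), 0 ≤ B →
      (∀ (k' : ℕ) (hk' : k' < k) (Y : (domSys P M (k' + 1)).Dom), ∀ φ' ∈ sp k' Y,
        aw k (k' + 1) * (Real.exp (κ * (domSys P M (k' + 1)).dj Y) * ‖o ⟨k' + 1, Nat.succ_lt_succ hk'⟩ Y φ' - o' ⟨k' + 1, Nat.succ_lt_succ hk'⟩ Y φ'‖) ≤ B) →
      ‖ρ k o - ρ k o'‖ ≤ B)
    (hρ₂ : ∀ (k : ℕ) (o₁ o₂ o₃ : OlderTerms P 𝔸 M k), Adm k o₁ → Adm k o₂ → Adm k o₃ → ∀ (B : ℝ), 0 ≤ B →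
      (∀ (k' : ℕ) (hk' : k' < k) (Y : (domSys P M (k' + 1)).Dom), ∀ φ' ∈ sp k' Y,
        aw k (k' + 1) * (Real.exp (κ * (domSys P M (k' + 1)).dj Y) *
          ‖o₁ ⟨k' + 1, Nat.succ_lt_succ hk'⟩ Y φ' - 2 * o₂ ⟨k' + 1, Nat.succ_lt_succ hk'⟩ Y φ' + o₃ ⟨k' + 1, Nat.succ_lt_succ hk'⟩ Y φ'‖) ≤ B) →
      ‖ρ k o₁ - (2 : ℂ) • ρ k o₂ + ρ k o₃‖ ≤ B)
    (haw : ∀ k j, 0 ≤ aw k j) (hawcw : ∀ k j, aw k j ≤ cw)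
    (hAdm : ∀ g ∈ Window γ, ∀ k, Adm k (olderOf (recTerm G fun n => ((g n : ℝ) : ℂ)) k))
    (hGt : ∀ (k : ℕ), ∀ t ∈ Ioc (0 : ℝ) γ, ∀ t' ∈ Ioc (0 : ℝ) γ, ∀ (old : OlderTerms P 𝔸 M k), Adm k old → ∀ (X : (domSys P M (k + 1)).Dom), ∀ φ ∈ sp k X,
      ‖(G k).E ((t : ℝ) : ℂ) old φ X - (G k).E ((t' : ℝ) : ℂ) old φ X‖ ≤ Real.exp (-(κ * (domSys P M (k + 1)).dj X)) * (lam k * |t - t'|))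
    (hlam : ∀ k, lam k ≤ ℓ₁) (hℓ₁ : 0 ≤ ℓ₁)
    (hG2last : ∀ (k : ℕ) (old : OlderTerms P 𝔸 M k), Adm k old → ∀ (t d : ℝ), 0 < d → t - d ∈ Ioc (0 : ℝ) γ → t + d ∈ Ioc (0 : ℝ) γ →
      ∀ (X : (domSys P M (k + 1)).Dom), ∀ φ ∈ sp k X,
        ‖(G k).E ((t + d : ℝ) : ℂ) old φ X - 2 * (G k).E ((t : ℝ) : ℂ) old φ X + (G k).E ((t - d : ℝ) : ℂ) old φ X‖ ≤
          Real.exp (-(κ * (domSys P M (k + 1)).dj X)) * (lam₂ k * d ^ 2))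
    (hlam₂ : ∀ k, lam₂ k ≤ ℓ₂) (hℓ₂ : 0 ≤ ℓ₂) (hC1 : 4 * Mb * cw / ϱ < 1) (K : ℕ) :
    ∀ (k : ℕ) (i : Fin (k + 1)), ∀ g ∈ box γ k, ∀ (X : (domSys P M (k + 1)).Dom), ∀ φ ∈ sp k X, ∀ t d : ℝ, 0 < d →
      t - d ∈ Ioc (0 : ℝ) γ → t + d ∈ Ioc (0 : ℝ) γ →
        ‖(truncRun K (toClusterTower G) k).E (Function.update g i (t + d)) φ X - 2 * (truncRun K (toClusterTower G) k).E (Function.update g i t) φ X +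
            (truncRun K (toClusterTower G) k).E (Function.update g i (t - d)) φ X‖ ≤
          max ℓ₂ (64 * Mb * cw ^ 2 / ϱ ^ 2 * ℓ₁ ^ 2 / (1 - 4 * Mb * cw / ϱ)) * Real.exp (-(κ * (domSys P M (k + 1)).dj X)) * d ^ 2 := by
  have hA2 := termSecondDiff_toClusterTower_of_analyticReadingNonexpansive G sp Adm ρ A hϱ hR hGA hA hMb hAdmr hρ₁ hρ₂ haw hawcw hAdm hGt hlam hℓ₁ hG2last hlam₂ hℓ₂ hC1
  have hM₂0 : 0 ≤ max ℓ₂ (64 * Mb * cw ^ 2 / ϱ ^ 2 * ℓ₁ ^ 2 / (1 - 4 * Mb * cw / ϱ)) := hℓ₂.trans (le_max_left _ _)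
  refine termSecondDiffAt_box_truncRun sp (toClusterTower G) K (T := fun _ _ => max ℓ₂ (64 * Mb * cw ^ 2 / ϱ ^ 2 * ℓ₁ ^ 2 / (1 - 4 * Mb * cw / ϱ)))
    (fun _ _ => hM₂0) ?_
  intro k i gb hgb X φ hφ t d hd hm hp
  -- extend the box history to a window history by `γ`
  obtain ⟨g, hg⟩ : ∃ g : ℕ → ℝ, g = fun n => if h : n < k + 1 then gb ⟨n, h⟩ else γ := ⟨_, rfl⟩
  have hgn : ∀ n (hn : n < k + 1), g n = gb ⟨n, hn⟩ := fun n hn => by rw [hg]; exact dif_pos hn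
  have hres : Node00.U3OfKernels.histPrefix g k = gb := funext fun j => hgn j j.2
  have hgW : g ∈ Window γ := by
    intro n
    by_cases hn : n < k + 1
    · rw [hgn n hn]; exact hgb ⟨n, hn⟩
    · have e : g n = γ := by rw [hg]; exact dif_neg hn
      rw [e]; exact ⟨hγ, le_rfl⟩
  have key := hA2 k g hgW i t d hd hm hp X φ hφ
  have hr : ∀ s : ℝ, termC (toClusterTower G) (k + 1) X (Function.update g i s) φ = (toClusterTower G k).E (Function.update gb i s) φ X := fun s => by
    rw [termC_succ, show restrictPrefix k (Function.update g (i : ℕ) s) = Node00.U3OfKernels.histPrefix (Function.update g (i : ℕ) s) k from rfl,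
      histPrefix_update g k i.2, hres]
  rwa [hr, hr, hr] at key

end Gen

end YMDAG.N22.TermRecursion

end
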